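import Summits.NavierStokesRegularity.NavierStokesRegularity.Theses.SlicedKelvin
import Summits.NavierStokesRegularity.NavierStokesRegularity.Theorems.SlicedKelvinDefs
import Summits.NavierStokesRegularity.NavierStokesRegularity.Theorems.SlicedKelvinPlanarFluxAPrioriStubInitialFluxFinite
import Summits.NavierStokesRegularity.NavierStokesRegularity.Theorems.SlicedKelvinPlanarFluxAPrioriHeatKernelDominationOfFoldLaw
import Summits.NavierStokesRegularity.NavierStokesRegularity.Theorems.SlicedKelvinPlanarFluxAPrioriStubDecayPersistence
import Summits.NavierStokesRegularity.NavierStokesRegularity.Theorems.SlicedKelvinPlanarFluxAPrioriStubEpsFoldLaw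
import Summits.NavierStokesRegularity.NavierStokesRegularity.Theorems.SlicedKelvinPlanarFluxAPrioriStubFoldLawPackage

/-!
# Crux `SlicedKelvin.PlanarFluxAPriori` (stmt-NavierStokesRegularity-15600), line `registered`:
  HEAT-KERNEL DOMINATION of the unsigned planar vorticity flux (closed), and the reduction of the crux to the
  FOLD-CREATION BUDGET (closed)

Two closed theorems assembling the landed stubs of the line (skeleton `Cruxes/PlanarFluxAPriori/Lines/birth.lean`,
rev 3):

* `heatKernelDomination` — the route's foreseen `HeatKernelFluxBound` (TWO-LAYER PLAN of route SlicedKelvin), i.e. the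
  rev-1 registered stub `stub_heatKernelDomination` of the skeleton, now PROVED: there is an absolute constant `C`
  (`= (4π)^{-1/2}`) such that along every classical Leray–Hopf solution on `[0,T)` from a rapidly decaying datum, for
  every frame `R`, height `c` and `t < T`,
  `Φ(t;R,c) ≤ ⨆_{c'} Φ(0;R,c') + C · liminf_{ε→0⁺} ∫⁻_{τ∈(0,t)} (ν(t−τ))^{-1/2} ∫⁻_{ℝ³} (s_ε(u τ;R))⁺`,
  `Φ` the unsigned flux of `curl u(t)` through `R{x₂ = c}` and `s_ε = Theorems.SlicedKelvin.foldDensity` the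
  ε-regularised fold-creation density. Proof: the landed glue `stub_heatKernelDomination_of_foldLawSubsolution`
  (1-D heat Duhamel comparison + Fubini over the foliation + ε → 0⁺) applied to the ε-fold-law subsolution package
  `stub_foldLawPackage stub_epsFoldLaw … (stub_decayPersistence …)` (fold-law identity, vorticity equation,
  differentiation under the plane integral, persistence of cubic decay).
* `planarFluxAPriori_of_foldCreationBudget` — the GLUED SPLIT certificate: the FOLD-CREATION BUDGET (the one open
  stub `stub_foldCreationBudget`: along every solution of the class the Duhamel fold-creation functional is bounded
  uniformly over frames and `t < T`) implies the crux `Theses.SlicedKelvin.PlanarFluxAPriori` BY NAME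
  (`ℝ≥0∞` bookkeeping with `stub_initialFluxFinite` and `heatKernelDomination`; `M := ↑(A + C·B)`).

Both statements are registered sub-goals of the crux item (A8). No new definitions; axioms standard.
-/

noncomputable section

-- Problem = summit for this single-conjunct summit: the duplicate namespace component is deliberate.
set_option linter.dupNamespace false

namespace Summit.NavierStokesRegularity.NavierStokesRegularity.Theorems.SlicedKelvinPlanarFluxAPriori

/-- **Heat-kernel domination of the unsigned planar vorticity flux** (route SlicedKelvin, `HeatKernelFluxBound`; the
rev-1 stub `stub_heatKernelDomination` of the crux skeleton, proved): `Φ(t;R,c) ≤ ⨆_{c'} Φ(0;R,c') + C · D(u;R,t)`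
with `D` the Duhamel fold-creation functional, `C = (4π)^{-1/2}`. -/
theorem heatKernelDomination : ∃ C : NNReal, ∀ (ν T : ℝ), 0 < ν → 0 < T → ∀ (u : ℝ → EuclideanSpace ℝ (Fin 3) → EuclideanSpace ℝ (Fin 3)) (p : ℝ → EuclideanSpace ℝ (Fin 3) → ℝ), Literature.Analysis.FluidPDE.IsClassicalNSSolutionOn (Set.Ico 0 T) ν 0 u p → Literature.Analysis.FluidPDE.IsLerayHopfOn T ν 0 (u 0) u → Literature.Analysis.FluidPDE.HasRapidSpatialDecay (u 0) → ∀ t ∈ Set.Ico 0 T, ∀ (R : EuclideanSpace ℝ (Fin 3) ≃ₗᵢ[ℝ] EuclideanSpace ℝ (Fin 3)) (c : ℝ), ∫⁻ y : EuclideanSpace ℝ (Fin 2), ‖inner ℝ (Literature.Analysis.FluidPDE.curl (u t) (R (WithLp.toLp 2 ![y 0, y 1, c]))) (R (EuclideanSpace.single 2 1))‖ₑ ≤ (⨆ c' : ℝ, ∫⁻ y : EuclideanSpace ℝ (Fin 2), ‖inner ℝ (Literature.Analysis.FluidPDE.curl (u 0) (R (WithLp.toLp 2 ![y 0, y 1,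 c']))) (R (EuclideanSpace.single 2 1))‖ₑ) + (C : ENNReal) * Filter.liminf (fun ε : ℝ => ∫⁻ τ in Set.Ioo 0 t, ENNReal.ofReal (1 / Real.sqrt (ν * (t - τ))) * (∫⁻ x : EuclideanSpace ℝ (Fin 3), ENNReal.ofReal (-(inner ℝ (u τ x) (R (EuclideanSpace.single 2 1))) * (ε ^ 2 / Real.sqrt (inner ℝ (Literature.Analysis.FluidPDE.curl (u τ) x) (R (EuclideanSpace.single 2 1)) ^ 2 + ε ^ 2) ^ 3) * (inner ℝ (Literature.Analysis.FluidPDE.curl (u τ) x) (R (EuclideanSpace.single 0 1)) * fderiv ℝ (fun z => inner ℝ (Literature.Analysis.FluidPDE.curl (u τ) z) (R (EuclideanSpace.single 2 1))) x (R (EuclideanSpace.single 0 1)) + inner ℝ (Literature.Analysis.FluidPDE.curl (u τ) x) (R (EuclideanSpace.single 1 1)) * fderiv ℝ (fun z => inner ℝ (Literature.Analysis.FluidPDE.curl (u τ) z) (R (EuclideanSpace.single 2 1))) x (R (EuclideanSpace.single 1 1))) - ε ^ 2 * fderiv ℝ (fun z => inner ℝ (u τ z) (R (EuclideanSpace.single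 2 1))) x (R (EuclideanSpace.single 2 1)) / Real.sqrt (inner ℝ (Literature.Analysis.FluidPDE.curl (u τ) x) (R (EuclideanSpace.single 2 1)) ^ 2 + ε ^ 2)))) (nhdsWithin 0 (Set.Ioi 0)) :=
  stub_heatKernelDomination_of_foldLawSubsolution
    (fun ν T hν hT u p hcl hLH hdec =>
      stub_foldLawPackage stub_epsFoldLaw ν T hν hT u p hcl (stub_decayPersistence ν T hν hT u p hcl hLH hdec))

/-- **The crux reduced to the fold-creation budget** (glued split `FoldCreationBudget → PlanarFluxAPriori` of route
SlicedKelvin's two-layer plan, closed): if along every classical Leray–Hopf solution on `[0,T)` from a rapidly decaying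
datum the Duhamel fold-creation functional is bounded uniformly over frames `R` and `t ∈ [0,T)`, then the unsigned
planar vorticity flux is bounded over all planes and all `t < T` — `Theses.SlicedKelvin.PlanarFluxAPriori`. -/
theorem planarFluxAPriori_of_foldCreationBudget : (∀ (ν T : ℝ), 0 < ν → 0 < T → ∀ (u : ℝ → EuclideanSpace ℝ (Fin 3) → EuclideanSpace ℝ (Fin 3)) (p : ℝ → EuclideanSpace ℝ (Fin 3) → ℝ), Literature.Analysis.FluidPDE.IsClassicalNSSolutionOn (Set.Ico 0 T) ν 0 u p → Literature.Analysis.FluidPDE.IsLerayHopfOn T ν 0 (u 0) u → Literature.Analysis.FluidPDE.HasRapidSpatialDecay (u 0) → ∃ B : NNReal, ∀ (R : EuclideanSpace ℝ (Fin 3) ≃ₗᵢ[ℝ] EuclideanSpace ℝ (Fin 3)), ∀ t ∈ Set.Ico 0 T, Filter.liminf (fun ε : ℝ => ∫⁻ τ in Set.Ioo 0 t, ENNReal.ofReal (1 / Real.sqrt (ν * (t - τ))) * (∫⁻ x : EuclideanSpace ℝ (Fin 3), ENNReal.ofReal (-(inner ℝ (u τ x) (R (EuclideanSpace.single 2 1)))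 * (ε ^ 2 / Real.sqrt (inner ℝ (Literature.Analysis.FluidPDE.curl (u τ) x) (R (EuclideanSpace.single 2 1)) ^ 2 + ε ^ 2) ^ 3) * (inner ℝ (Literature.Analysis.FluidPDE.curl (u τ) x) (R (EuclideanSpace.single 0 1)) * fderiv ℝ (fun z => inner ℝ (Literature.Analysis.FluidPDE.curl (u τ) z) (R (EuclideanSpace.single 2 1))) x (R (EuclideanSpace.single 0 1)) + inner ℝ (Literature.Analysis.FluidPDE.curl (u τ) x) (R (EuclideanSpace.single 1 1)) * fderiv ℝ (fun z => inner ℝ (Literature.Analysis.FluidPDE.curl (u τ) z) (R (EuclideanSpace.single 2 1))) x (R (EuclideanSpace.single 1 1))) - ε ^ 2 * fderiv ℝ (fun z => inner ℝ (u τ z) (R (EuclideanSpace.single 2 1))) x (R (EuclideanSpace.single 2 1)) / Real.sqrt (inner ℝ (Literature.Analysis.FluidPDE.curl (u τ) x) (R (EuclideanSpace.single 2 1)) ^ 2 + ε ^ 2)))) (nhdsWithin 0 (Set.Ioi 0)) ≤ (B : ENNReal)) → Summit.NavierStokesRegularity.NavierStokesRegularity.Theses.SlicedKelvin.PlanarFluxAPriori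 := by
  intro hB ν T hν hT u p hcl hLH hdec
  obtain ⟨A, hA⟩ := stub_initialFluxFinite (u 0) hdec
  obtain ⟨C, hC⟩ := heatKernelDomination
  obtain ⟨B, hB'⟩ := hB ν T hν hT u p hcl hLH hdec
  refine ⟨((A + C * B : NNReal) : ℝ), ?_⟩
  intro t ht R c
  have h1 := hC ν T hν hT u p hcl hLH hdec t ht R c
  have h2 := hB' R t ht
  refine h1.trans ?_
  refine (add_le_add (iSup_le fun c' => hA R c') (mul_le_mul' le_rfl h2)).trans_eq ?_
  rw [ENNReal.ofReal_coe_nnreal, ENNReal.coe_add, ENNReal.coe_mul]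

end Summit.NavierStokesRegularity.NavierStokesRegularity.Theorems.SlicedKelvinPlanarFluxAPriori

end
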